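import Summits.NavierStokesRegularity.NavierStokesRegularity.Theorems.ScenarioCensusRowF1InviscidZoom
import HarnessLib

/-!
# LINE «inviscid-top» port, part 3/5: Liouville theorems on the ancient side — harmonic slices and their ε(M)-stable forms (§4)

Re-homed for the scenario census (typer seat ns-census-typer-1 g8; the cells F1vfq ⊇ F1afq, F1vgq and the o-forms F1vf / F1vg / F1af are MEMBERS OF RECORD
«DECIDED IN KERNEL IN FILES» of row F1 since census v1.71 (critic idea-crit-3 PASS 21:40:30Z; ref ns-census-ref g8 PRE-CHECK ✓ §13.14 item 17; lead-presearch
label); this port makes them TREE-decided): VERBATIM PORT of ns-idea-3 LINE 18 «inviscid-top», `pub/ideators/ns-idea-3/lines/inviscid-top/line-inviscid-top.lean`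
sha16 75cdf592fc13b830 (1259 l., lean check rc 0, 0 sorry), split for the 400-line rule into `ScenarioCensusRowF1Inviscid` (§1–§2) → `…InviscidZoom` (§3) →
`…InviscidLiouville` (§4) → `…InviscidTransfer` (§5) → `…InviscidTop` (§6 + census KEYS).  Lean text VERBATIM in namespace `…Theorems.ScenarioCensus.InviscidTop`
(the line's `…Cruxes.ScenarioCensusRowF1.InviscidTopLine` re-homed); port edits: `@[conjecture]` on the residual `LaplacianDefectSlack` (≡ `ScenarioCensus.Row_F1`,
OPEN), fifteen one-line docstrings added (gate lint).

No census VALUE is moved here (row F1 stays OPEN-WITH-LINE; the members become TREE-decided by name); NS regularity is NOT proved; `Row_F1` is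
untouched (zero movement, `laplacianDefectSlack_iff_rowF1`); no summit statement is proved by this file. Lemmas that restate already-landed tree declarations are taken BY NAME (gate lint `dedup.landed`): `tendsto_physicalTime` = `ColumnarTop.tendsto_physicalTime`, `eventually_fast` = `ColumnarTop.eventually_fast`, `sqrt_timeLag` = `StretchedTop.sqrt_timeLag`, `forall_of_forall_ne_zero` = `StretchedTop.forall_of_forall_ne_zero`.
-/

-- the summit and its single problem share the name `NavierStokesRegularity` (D-0017 nested layout)
set_option linter.dupNamespace false

noncomputable section

open MeasureTheory Set Function Filter TopologicalSpace Metric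
open scoped Topology NNReal ENNReal InnerProductSpace RealInnerProductSpace Laplacian

namespace Summit.NavierStokesRegularity.NavierStokesRegularity.Theorems.ScenarioCensus.InviscidTop

open Literature.Analysis Literature.Analysis.FluidPDE
open Summit.NavierStokesRegularity.NavierStokesRegularity.Theorems

/-! ## §4 Liouville theorems on the ancient side: harmonic slices and their ε(M)-stable forms -/

/-- The trace read-out as a continuous linear map (for analyticity of `y ↦ Δ W(s, y)`). -/
def lapCLM : Hess →L[ℝ] E3 :=
  ∑ i, (ContinuousLinearMap.apply ℝ E3 (eI i)).comp (ContinuousLinearMap.apply ℝ (E3 →L[ℝ] E3) (eI i))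

/-- `lapCLM` computes `lapOf`. -/
theorem lapCLM_apply (H : Hess) : lapCLM H = lapOf H := by
  simp only [lapCLM, lapOf, _root_.sum_apply, ContinuousLinearMap.comp_apply,
    ContinuousLinearMap.apply_apply]

/-- `|vᵢ| ≤ ‖v‖` in `ℝ³` (auxiliary). -/
theorem abs_le_norm_euclidean (i : Fin 3) (v : E3) : |v i| ≤ ‖v‖ := by
  have h := EuclideanSpace.norm_eq v
  calc |v i| = Real.sqrt (|v i| ^ 2) := by rw [Real.sqrt_sq (abs_nonneg _)]
    _ = Real.sqrt (‖v i‖ ^ 2) := by rw [Real.norm_eq_abs]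
    _ ≤ Real.sqrt (∑ j, ‖v j‖ ^ 2) :=
        Real.sqrt_le_sqrt (Finset.single_le_sum (fun j _ => sq_nonneg ‖v j‖) (Finset.mem_univ i))
    _ = ‖v‖ := h.symm

/-- **A slice of a `𝒦_C` field with harmonic velocity is constant** (bounded harmonic functions on `ℝ³`
are constant, componentwise: tree `HarmonicOnNhd.apply_eq_apply_of_abs_le`). -/
theorem slice_const_of_laplacian_eq_zero {C : ℝ} {W : ℝ → E3 → E3} (hW : IsTypeIAncientMild C W)
    {s : ℝ} (hs : s < 0) (hΔ : ∀ y, (Δ (W s)) y = 0) : ∀ y, W s y = W s 0 := by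
  have h2 : ContDiff ℝ 2 (W s) := (hW.contDiff_slice hs).of_le (by norm_cast)
  have hcomp : ∀ (i : Fin 3) (y : E3), W s y i = W s 0 i := by
    intro i y
    set η : E3 → ℝ := fun z => W s z i with hη
    have hηdef : η = fun z => (EuclideanSpace.proj i : E3 →L[ℝ] ℝ) (W s z) := rfl
    have hη2 : ContDiff ℝ 2 η := by
      rw [hηdef]; exact (EuclideanSpace.proj i : E3 →L[ℝ] ℝ).contDiff.comp h2
    have hηΔ : ∀ z, (Δ η) z = 0 := by
      intro z
      rw [hηdef, show (fun z => (EuclideanSpace.proj i : E3 →L[ℝ] ℝ) (W s z)) =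
        (EuclideanSpace.proj i : E3 →L[ℝ] ℝ) ∘ W s from rfl,
        (h2.contDiffAt (x := z)).laplacian_CLM_comp_left, Function.comp_apply, hΔ z, map_zero]
    have hharm : InnerProductSpace.HarmonicOnNhd η univ := harmonicOnNhd_of_laplacian_eq_zero hη2 hηΔ
    have hbd : ∀ z, |η z| ≤ C / Real.sqrt (-s) := fun z =>
      (abs_le_norm_euclidean i (W s z)).trans (hW.norm_le hs z)
    exact hharm.apply_eq_apply_of_abs_le hbd y 0
  intro y
  ext i
  exact hcomp i y

/-- **EXACT LIOUVILLE, one harmonic slice** (new A-row, in kernel): `W ∈ 𝒦_C` and `Δ W(s, ·) ≡ 0` for ONE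
`s < 0` ⇒ `W ≡ 0` (constant slice ⇒ translation-invariant slice ⇒ (N₁) one-slice rigidity of the tree). -/
theorem eq_zero_of_laplacian_slice_eq_zero {C : ℝ} {W : ℝ → E3 → E3} (hW : IsTypeIAncientMild C W)
    {s : ℝ} (hs : s < 0) (hΔ : ∀ y, (Δ (W s)) y = 0) : ∀ t < 0, ∀ x, W t x = 0 := by
  have hconst := slice_const_of_laplacian_eq_zero hW hs hΔ
  have he : (eI 0 : E3) ≠ 0 := fun h => by simpa using congrArg (fun w : E3 => w 0) h
  exact PoloidalWindowDoorPoloidalWindowRigidityOneSlice.eq_zero_of_translate_eq_slice hW.hasTypeITimeDecay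
    hW.continuousOn_uncurry (fun s' t hst ht x => hW.mild_eq_heatExtension hst ht x)
    (fun t ht => hW.isDivFree ht) hs he fun y l => by rw [hconst (y + l • eI 0), hconst y]

/-- `Δ W(s, ·)` is the composition of a fixed linear read-out with the (analytic) Hessian. -/
theorem laplacian_eq_lapCLM_comp (v : E3 → E3) : Δ v = lapCLM ∘ fun x => fderiv ℝ (fderiv ℝ v) x := by
  funext x
  rw [Function.comp_apply, lapCLM_apply, laplacian_eq_lapOf]

/-- **EXACT LIOUVILLE, locally harmonic slice** (in kernel): `Δ W(s, ·) = 0` NEAR ONE POINT of ONE slice ⇒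
`W ≡ 0` (the slice Laplacian is real-analytic: identity theorem, then the one-slice theorem). -/
theorem eq_zero_of_laplacian_eventuallyEq_zero {C : ℝ} {W : ℝ → E3 → E3} (hW : IsTypeIAncientMild C W)
    {s : ℝ} (hs : s < 0) {y₀ : E3} (hloc : ∀ᶠ y in 𝓝 y₀, (Δ (W s)) y = 0) : ∀ t < 0, ∀ x, W t x = 0 := by
  have han : AnalyticOnNhd ℝ (Δ (W s)) univ := by
    rw [laplacian_eq_lapCLM_comp]
    exact lapCLM.comp_analyticOnNhd (hW.analyticOnNhd_slice_univ hs).fderiv.fderiv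
  have key := han.eqOn_zero_of_preconnected_of_eventuallyEq_zero isPreconnected_univ (mem_univ y₀) hloc
  exact eq_zero_of_laplacian_slice_eq_zero hW hs fun y => key (mem_univ y)

/-- **EXACT LIOUVILLE, uniform vorticity on one slice** (in kernel): `∇ω_W(s, ·) ≡ 0` for ONE `s < 0` ⇒
`W ≡ 0` (constant vorticity slice is harmonic: the tree's stratum (B) `eq_zero_of_curl_harmonic_slice`). -/
theorem eq_zero_of_vorticityGradient_slice_eq_zero {C : ℝ} {W : ℝ → E3 → E3} (hW : IsTypeIAncientMild C W)
    {s : ℝ} (hs : s < 0) (h : ∀ y, fderiv ℝ (curl (W s)) y = 0) : ∀ t < 0, ∀ x, W t x = 0 := by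
  have hC3 : ContDiff ℝ (2 + 1) (W s) := (hW.contDiff_slice hs).of_le (by norm_cast)
  have hω2 : ContDiff ℝ 2 (curl (W s)) := contDiff_curl hC3
  have hdiff : Differentiable ℝ (curl (W s)) := hω2.differentiable (by norm_num)
  have hc : curl (W s) = fun _ => curl (W s) 0 := funext fun x => is_const_of_fderiv_eq_zero hdiff h x 0
  have hΔω : ∀ y, (Δ (curl (W s))) y = 0 := fun y => by
    rw [hc, InnerProductSpace.laplacian_const]; rfl
  exact PoloidalWindowDoorPoloidalWindowRigidityVorticityTranslate.eq_zero_of_curl_harmonic_slice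
    hW.hasTypeITimeDecay hW.continuousOn_uncurry (fun s' t hst ht x => hW.mild_eq_heatExtension hst ht x)
    (fun t ht => hW.isDivFree ht) hs hΔω

/-- **EXACT LIOUVILLE, affine slice** (in kernel): `∇²W(s, ·) ≡ 0` for ONE `s < 0` ⇒ `W ≡ 0`. -/
theorem eq_zero_of_hessian_slice_eq_zero {C : ℝ} {W : ℝ → E3 → E3} (hW : IsTypeIAncientMild C W)
    {s : ℝ} (hs : s < 0) (h : ∀ y, fderiv ℝ (fderiv ℝ (W s)) y = 0) : ∀ t < 0, ∀ x, W t x = 0 :=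
  eq_zero_of_laplacian_slice_eq_zero hW hs fun y => by
    rw [laplacian_eq_lapOf, h y]; simp [lapOf]

/-- **COMPACTNESS UPGRADE, second order (the engine).**  Let `R ≥ 0` be a continuous, positively homogeneous
read-out of the Hessian (so that `(−s)^{3/2} R(∇²W(s, y))` is invariant under the `𝒦`-zoom).  If the EXACT
Liouville theorem «`R(∇²W) ≡ 0 ⇒ W ≡ 0`» holds in `𝒦_M`, then ONE `ε = ε(M, R) > 0` works:
`(−s)^{3/2} R(∇²W(s, y)) ≤ ε` everywhere ⇒ `W ≡ 0`.  Proof: normalise a bad sequence by census row A2a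
(`θ = 1/2`) and the zoom, extract a `C²_loc` limit in `𝒦_M` (tree `C¹_loc` extraction + the Hessian upgrade of
§2): it is nontrivial with `R(∇²·) ≡ 0`. -/
theorem exists_eps_liouville₂ (M : ℝ) {R : Hess → ℝ} (hRc : Continuous R) (hR0 : ∀ H, 0 ≤ R H)
    (hRh : ∀ a : ℝ, 0 < a → ∀ H, R (a • H) = a * R H)
    (hL : ∀ W : ℝ → E3 → E3, IsTypeIAncientMild M W →
      (∀ s < (0 : ℝ), ∀ y : E3, R (fderiv ℝ (fderiv ℝ (W s)) y) = 0) → ∀ s < (0 : ℝ), ∀ y : E3, W s y = 0) :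
    ∃ ε : ℝ, 0 < ε ∧ ∀ W : ℝ → E3 → E3, IsTypeIAncientMild M W →
      (∀ s < (0 : ℝ), ∀ y : E3, (-s) * Real.sqrt (-s) * R (fderiv ℝ (fderiv ℝ (W s)) y) ≤ ε) →
      ∀ s < (0 : ℝ), ∀ y : E3, W s y = 0 := by
  by_contra hcon
  have hseq : ∀ n : ℕ, ∃ W : ℝ → E3 → E3, IsTypeIAncientMild M W ∧
      (∀ s < (0 : ℝ), ∀ y : E3,
        (-s) * Real.sqrt (-s) * R (fderiv ℝ (fderiv ℝ (W s)) y) ≤ 1 / ((n : ℝ) + 1)) ∧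
      ∃ s < (0 : ℝ), ∃ y : E3, W s y ≠ 0 := by
    intro n
    by_contra h
    push Not at h
    exact hcon ⟨1 / ((n : ℝ) + 1), by positivity, h⟩
  choose W hW hD hnz using hseq
  -- ## (1) normalisation (census row A2a, `θ = 1/2`)
  have hbig : ∀ n, ∃ t < (0 : ℝ), ∃ x : E3, (1 / 2 : ℝ) / Real.sqrt (-t) < ‖W n t x‖ := by
    intro n
    by_contra hc
    push Not at hc
    have hhalf : IsTypeIAncientMild (1 / 2) (W n) :=
      ⟨(hW n).1, (hW n).2.1, (hW n).2.2.1, fun t ht x => hc t ht x⟩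
    obtain ⟨s, hs, y, hy⟩ := hnz n
    exact hy (ScenarioCensus.row_A2a_excluded (1 / 2) (by norm_num) (W n) hhalf s hs y)
  choose T hT X hX using hbig
  -- ## (2) zoom about `(T n, X n)` by `λ_n = √(-T n)`
  set lam : ℕ → ℝ := fun n => Real.sqrt (-T n) with hlam
  have hlam0 : ∀ n, 0 < lam n := fun n => Real.sqrt_pos.2 (neg_pos.2 (hT n))
  have hlam2 : ∀ n, lam n ^ 2 = -T n := fun n => Real.sq_sqrt (neg_pos.2 (hT n)).le
  set v : ℕ → ℝ → E3 → E3 := fun n => lam n • stPull (lam n ^ 2) (lam n) 0 (X n) (W n) with hv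
  have hvA : ∀ n, IsTypeIAncientMild M (v n) := fun n => isTypeIAncientMild_zoom (hW n) (hlam0 n) (X n)
  have hv_apply : ∀ n (s : ℝ) (y : E3), v n s y = lam n • W n (lam n ^ 2 * s) (X n + lam n • y) :=
    fun n s y => zoom_apply (lam n) (X n) (W n) s y
  have hv_hess : ∀ n (s : ℝ) (y : E3), fderiv ℝ (fderiv ℝ (v n s)) y =
      (lam n ^ 3) • fderiv ℝ (fderiv ℝ (W n (lam n ^ 2 * s))) (X n + lam n • y) :=
    fun n s y => fderiv_fderiv_zoom (lam n) (X n) (W n) s y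
  have hv_big : ∀ n, (1 / 2 : ℝ) < ‖v n (-1) 0‖ := by
    intro n
    rw [hv_apply, smul_zero, add_zero, mul_neg_one, hlam2, neg_neg, norm_smul, Real.norm_eq_abs,
      abs_of_pos (hlam0 n)]
    have h := hX n
    rw [div_lt_iff₀ (hlam0 n)] at h
    linarith [mul_comm (lam n) ‖W n (T n) (X n)‖]
  have hv_def : ∀ n, ∀ s < (0 : ℝ), ∀ y : E3,
      (-s) * Real.sqrt (-s) * R (fderiv ℝ (fderiv ℝ (v n s)) y) ≤ 1 / ((n : ℝ) + 1) := by
    intro n s hs y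
    have hs' : lam n ^ 2 * s < 0 := mul_neg_of_pos_of_neg (pow_pos (hlam0 n) 2) hs
    have key : ∀ Xr : ℝ, (-s) * Real.sqrt (-s) * (lam n ^ 3 * Xr) =
        (-(lam n ^ 2 * s)) * Real.sqrt (-(lam n ^ 2 * s)) * Xr := by
      intro Xr
      rw [show -(lam n ^ 2 * s) = lam n ^ 2 * (-s) by ring, Real.sqrt_mul (sq_nonneg _),
        Real.sqrt_sq (hlam0 n).le]
      ring
    rw [hv_hess, hRh _ (pow_pos (hlam0 n) 3), key]
    exact hD n _ hs' _
  -- ## (3) the `C²_loc` extraction in `𝒦_M`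
  obtain ⟨φ, hφ, U, hU, hconv, hgrad, -, -⟩ := exists_tendsto_of_isTypeIAncientMild_seq M hvA
  have hhess := tendsto_fderiv_fderiv_of_isTypeIAncientMild_seq (v := fun j => v (φ j))
    (fun j => hvA (φ j)) hU hgrad
  have hφt : Tendsto φ atTop atTop := hφ.tendsto_atTop
  have hDU : ∀ s < (0 : ℝ), ∀ y : E3, R (fderiv ℝ (fderiv ℝ (U s)) y) = 0 := by
    intro s hs y
    have hlimD : Tendsto (fun j => (-s) * Real.sqrt (-s) * R (fderiv ℝ (fderiv ℝ (v (φ j) s)) y)) atTop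
        (𝓝 ((-s) * Real.sqrt (-s) * R (fderiv ℝ (fderiv ℝ (U s)) y))) :=
      ((hRc.tendsto _).comp (hhess s hs y)).const_mul _
    have hzero : Tendsto (fun j => 1 / ((φ j : ℝ) + 1)) atTop (𝓝 0) :=
      tendsto_one_div_add_atTop_nhds_zero_nat.comp hφt
    have hle : (-s) * Real.sqrt (-s) * R (fderiv ℝ (fderiv ℝ (U s)) y) ≤ 0 :=
      le_of_tendsto_of_tendsto hlimD hzero (Eventually.of_forall fun j => hv_def (φ j) s hs y)
    have hw : 0 < (-s) * Real.sqrt (-s) := mul_pos (neg_pos.2 hs) (Real.sqrt_pos.2 (neg_pos.2 hs))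
    have hn : R (fderiv ℝ (fderiv ℝ (U s)) y) ≤ 0 := by
      by_contra hpos
      push Not at hpos
      exact absurd hle (not_le.2 (mul_pos hw hpos))
    exact le_antisymm hn (hR0 _)
  have hUbig : (1 / 2 : ℝ) ≤ ‖U (-1) 0‖ :=
    ge_of_tendsto ((hconv (-1) (by norm_num) 0).norm) (Eventually.of_forall fun j => (hv_big (φ j)).le)
  have hU0 : U (-1) 0 = 0 := hL U hU hDU (-1) (by norm_num) 0
  rw [hU0, norm_zero] at hUbig
  linarith

/-- **ε-LIOUVILLE, almost-harmonic velocity** (new A-row, in kernel): ∀ M ∃ ε(M) > 0: `W ∈ 𝒦_M` with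
`(−s)^{3/2} ‖Δ W(s, y)‖ ≤ ε` everywhere ⇒ `W ≡ 0`. -/
theorem exists_eps_liouville_laplacian (M : ℝ) : ∃ ε : ℝ, 0 < ε ∧ ∀ W : ℝ → E3 → E3,
    IsTypeIAncientMild M W → (∀ s < (0 : ℝ), ∀ y : E3, (-s) * Real.sqrt (-s) * ‖(Δ (W s)) y‖ ≤ ε) →
    ∀ s < (0 : ℝ), ∀ y : E3, W s y = 0 := by
  obtain ⟨ε, hε, h⟩ := exists_eps_liouville₂ M (R := fun H => ‖lapOf H‖) (continuous_lapOf.norm)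
    (fun H => norm_nonneg _) (fun a ha H => by
      show ‖lapOf (a • H)‖ = a * ‖lapOf H‖
      rw [lapOf_smul, norm_smul, Real.norm_eq_abs, abs_of_pos ha])
    (fun W hW h0 => eq_zero_of_laplacian_slice_eq_zero hW (s := -1) (by norm_num) fun y => by
      rw [laplacian_eq_lapOf]; exact norm_eq_zero.1 (h0 (-1) (by norm_num) y))
  exact ⟨ε, hε, fun W hW hb => h W hW fun s hs y => by rw [← laplacian_eq_lapOf]; exact hb s hs y⟩

/-- **ε-LIOUVILLE, almost-uniform vorticity** (in kernel): ∀ M ∃ ε(M) > 0: `(−s)^{3/2} ‖∇ω_W(s, y)‖ ≤ ε`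
everywhere ⇒ `W ≡ 0`. -/
theorem exists_eps_liouville_vorticityGradient (M : ℝ) : ∃ ε : ℝ, 0 < ε ∧ ∀ W : ℝ → E3 → E3,
    IsTypeIAncientMild M W →
    (∀ s < (0 : ℝ), ∀ y : E3, (-s) * Real.sqrt (-s) * ‖fderiv ℝ (curl (W s)) y‖ ≤ ε) →
    ∀ s < (0 : ℝ), ∀ y : E3, W s y = 0 := by
  have hslice : ∀ {W : ℝ → E3 → E3}, IsTypeIAncientMild M W → ∀ s < (0 : ℝ), ∀ y : E3,
      fderiv ℝ (curl (W s)) y = vortGradOf (fderiv ℝ (fderiv ℝ (W s)) y) := fun hW s hs y =>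
    fderiv_curl_eq_vortGradOf (hW.contDiff_slice hs) (by norm_cast) y
  obtain ⟨ε, hε, h⟩ := exists_eps_liouville₂ M (R := fun H => ‖vortGradOf H‖) (continuous_vortGradOf.norm)
    (fun H => norm_nonneg _) (fun a ha H => by
      show ‖vortGradOf (a • H)‖ = a * ‖vortGradOf H‖
      rw [vortGradOf_smul, norm_smul, Real.norm_eq_abs, abs_of_pos ha])
    (fun W hW h0 => eq_zero_of_vorticityGradient_slice_eq_zero hW (s := -1) (by norm_num) fun y => by
      rw [hslice hW (-1) (by norm_num)]; exact norm_eq_zero.1 (h0 (-1) (by norm_num) y))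
  exact ⟨ε, hε, fun W hW hb => h W hW fun s hs y => by rw [← hslice hW s hs]; exact hb s hs y⟩

/-- **ε-LIOUVILLE, almost-affine velocity** (in kernel): ∀ M ∃ ε(M) > 0: `(−s)^{3/2} ‖∇²W(s, y)‖ ≤ ε`
everywhere ⇒ `W ≡ 0` (from the almost-harmonic one: `‖Δ‖ ≤ 3 ‖∇²‖`). -/
theorem exists_eps_liouville_hessian (M : ℝ) : ∃ ε : ℝ, 0 < ε ∧ ∀ W : ℝ → E3 → E3,
    IsTypeIAncientMild M W →
    (∀ s < (0 : ℝ), ∀ y : E3, (-s) * Real.sqrt (-s) * ‖fderiv ℝ (fderiv ℝ (W s)) y‖ ≤ ε) →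
    ∀ s < (0 : ℝ), ∀ y : E3, W s y = 0 := by
  obtain ⟨ε, hε, h⟩ := exists_eps_liouville_laplacian M
  refine ⟨ε / 3, by positivity, fun W hW hb s hs y => h W hW (fun s' hs' y' => ?_) s hs y⟩
  have hw : 0 ≤ (-s') * Real.sqrt (-s') := by
    have := neg_pos.2 hs'
    positivity
  calc (-s') * Real.sqrt (-s') * ‖(Δ (W s')) y'‖
      ≤ (-s') * Real.sqrt (-s') * (3 * ‖fderiv ℝ (fderiv ℝ (W s')) y'‖) := by
        rw [laplacian_eq_lapOf]
        exact mul_le_mul_of_nonneg_left (norm_lapOf_le _) hw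
    _ = 3 * ((-s') * Real.sqrt (-s') * ‖fderiv ℝ (fderiv ℝ (W s')) y'‖) := by ring
    _ ≤ 3 * (ε / 3) := by linarith [hb s' hs' y']
    _ = ε := by ring

end Summit.NavierStokesRegularity.NavierStokesRegularity.Theorems.ScenarioCensus.InviscidTop

end
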